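import Literature.NumberTheory.Automorphic.LevelActionTransferHecke
import Literature.NumberTheory.Automorphic.HidaLevelAdaptedFamily
import Literature.NumberTheory.Automorphic.HidaLevelDiamondAction
import Literature.NumberTheory.Automorphic.HidaTowerLevelActionBridge
import Literature.NumberTheory.Automorphic.LevelActionNormalizingHecke
import Literature.NumberTheory.Automorphic.HidaTowerLevelsHecke
import HarnessLib

/-!
# `res` and `tr` between the Hida levels `U(b, c)` commute with all Hecke operators of Hida elements

Topic `NumberTheory/Automorphic`; namespace `Literature.NumberTheory.Automorphic.BigHeckeGLn.TameLevel`;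
theorems only (no new definitions, no named fact, no `sorry`).

`GL₂` over a number field, tame level `U` maximal above `p`, trivial coefficients `k/p^s`
(`laCohomology`, `laHecke` of `HidaTowerLevelActionBridge`).  For two Hida levels
`U(b₂, c₂) ≤ U(b₁, c₁)` (`c₁, c₂ ≥ 1`) and every Hida element `g` (`T_{w,j}`, `T_{w,2}⁻¹` at good `w`,
`U_{v,j}`, `U_{v,2}⁻¹`, `⟨u⟩_v` at `v ∣ p`) the two double cosets `U(b_i,c_i) g U(b_i,c_i)` have a
COMMON family of representatives (local cosets at a good place; the unipotent family `N(x) t_v` at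
`v ∣ p`; `g` itself when `g` normalises), so that **`res` commutes with `[· g ·]`**
(`resCohomology_comp_laHecke`); and for `U(b, c) ≤ U(b', c)` (`b' ≤ b ≤ c`, `1 ≤ c`) the diamond
transversal of `U(b',c)/U(b,c)` permutes these representatives (`diamondPi` commutes with elements
away from `p`, with diagonal elements, and conjugates `N(x) t_v` to `N(x') t_v`), so that **`tr`
commutes with `[· g ·]`** (`trCohomology_comp_laHecke`).  These are the Hecke-equivariance inputs of
the transport of annihilators between the factors of the Hida tower.

[cite: Hida1994AIF, §2] [cite: KhareThorne2017, §6.2, Lemma 6.5]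

## References

* H. Hida, Ann. Inst. Fourier 44 (1994), §2. [Hida1994AIF]
* C. Khare, J. A. Thorne, Amer. J. Math. 139 (2017), §6.2. [KhareThorne2017]
-/

noncomputable section

open CategoryTheory IsDedekindDomain
open scoped NumberField

namespace Literature.NumberTheory.Automorphic

namespace BigHeckeGLn

namespace TameLevel

open LevelAction

variable {K : Type} [Field K] [NumberField K] {p : ℕ} [Fact p.Prime] (𝒰 : TameLevel 2 K p)
  {v : HeightOneSpectrum (𝓞 K)}

/-! ### The unipotent family represents `U t^a U / U` at every level `U = U(b, c)`, `c ≥ a` -/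

/-- **`j ↦ N(x_j) t^a U(b,c)` is a bijection onto `U(b,c) t^a U(b,c) / U(b,c)`** for the unipotent family
indexed by `U(c₀,c₀) t^a U(c₀,c₀)/U(c₀,c₀)` (`a ≤ c₀`, `a ≤ c`): the cosets `N(x) t^a U(b,c)` only
depend on `x mod ϖ^a`. [cite: KhareThorne2017, §6.2, Lemma 6.5] -/
theorem coe_unipotentFamily_bijOn_level (h𝒰 : 𝒰.IsMaximalAbove) (hv : (p : 𝓞 K) ∈ v.asIdeal)
    {c₀ a : ℕ} (ha₀ : a ≤ c₀) {b c : ℕ} (ha : a ≤ c) :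
    Set.BijOn (fun j => ((𝒰.unipotentFamily (v := v) c₀ a j : FiniteAdelicGL 2 K) :
        FiniteAdelicGL 2 K ⧸ 𝒰.level b c)) Set.univ
      (ArithmeticQuotient.doubleCosetQuot (𝒰.level b c) (heckeElement 2 K v 1 ^ a)) := by
  refine ⟨fun j _ => ?_, fun j₁ _ j₂ _ h => ?_, fun d hd => ?_⟩
  · exact 𝒰.coe_globalUnipotent_mul_mem_doubleCosetQuot h𝒰 hv b c a (𝒰.unipotentRep_spec h𝒰 hv ha₀ j.2).1
  · simp only at h
    rw [𝒰.globalUnipotent_coset_eq_iff h𝒰 hv] at h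
    rw [← 𝒰.globalUnipotent_coset_eq_iff h𝒰 hv c₀ c₀] at h
    rw [(𝒰.unipotentRep_spec h𝒰 hv ha₀ j₁.2).2, (𝒰.unipotentRep_spec h𝒰 hv ha₀ j₂.2).2] at h
    exact Subtype.ext h
  · obtain ⟨x, hx1, hx⟩ := 𝒰.exists_globalUnipotent_coe_eq h𝒰 hv ha hd
    refine ⟨⟨_, 𝒰.coe_globalUnipotent_mul_mem_doubleCosetQuot h𝒰 hv c₀ c₀ a hx1⟩, Set.mem_univ _, ?_⟩
    simp only
    rw [← hx, 𝒰.globalUnipotent_coset_eq_iff h𝒰 hv, ← 𝒰.globalUnipotent_coset_eq_iff h𝒰 hv c₀ c₀]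
    exact (𝒰.unipotentRep_spec h𝒰 hv ha₀ (𝒰.coe_globalUnipotent_mul_mem_doubleCosetQuot h𝒰 hv c₀ c₀ a hx1)).2

/-! ### `diamondPi u` permutes the unipotent cosets -/

/-- **`(∏_w ⟨u_w⟩_w) · N(x) t^a = N(u₀ x u₁⁻¹) t^a · (∏_w ⟨u_w⟩_w)`** (`u₀, u₁` the `v`-components).
[folklore] -/
theorem diamondPi_mul_globalUnipotent_mul (hv : (p : 𝓞 K) ∈ v.asIdeal)
    (u : ∀ w : PlacesAbove K p, (Fin 2 → (w.1.adicCompletionIntegers K)ˣ)) (x : v.adicCompletion K) (a : ℕ) :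
    diamondPi 2 K p u * (globalUnipotent K v x * heckeElement 2 K v 1 ^ a) =
      globalUnipotent K v ((unitsToLocal 2 v (u ⟨v, hv⟩) 0 : (v.adicCompletion K)ˣ) * x *
          ((unitsToLocal 2 v (u ⟨v, hv⟩) 1)⁻¹ : (v.adicCompletion K)ˣ)) *
        heckeElement 2 K v 1 ^ a * diamondPi 2 K p u := by
  -- split off the `v`-factor: `s = ⟨u_v⟩_v s'` with `s'_v = 1`
  set s' := (diamondElement 2 K v (u ⟨v, hv⟩))⁻¹ * diamondPi 2 K p u with hs'
  have hs'v : localComponent 2 K v s' = 1 := by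
    rw [hs', map_mul, map_inv, localComponent_diamondPi u ⟨v, hv⟩, diamondElement_apply,
      localComponent_ofLocal, inv_mul_cancel]
  have hs : diamondPi 2 K p u = diamondElement 2 K v (u ⟨v, hv⟩) * s' := by
    rw [hs', mul_inv_cancel_left]
  clear_value s'
  have hcomm : s' * (globalUnipotent K v x * heckeElement 2 K v 1 ^ a) =
      globalUnipotent K v x * heckeElement 2 K v 1 ^ a * s' := by
    rw [globalUnipotent, heckeElement_one_pow_eq_ofLocal v a, ← map_mul]
    exact mul_ofLocal_comm hs'v _
  have h1 : diamondElement 2 K v (u ⟨v, hv⟩) * globalUnipotent K v x =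
      globalUnipotent K v ((unitsToLocal 2 v (u ⟨v, hv⟩) 0 : (v.adicCompletion K)ˣ) * x *
          ((unitsToLocal 2 v (u ⟨v, hv⟩) 1)⁻¹ : (v.adicCompletion K)ˣ)) * diamondElement 2 K v (u ⟨v, hv⟩) := by
    rw [← diamondElement_mul_globalUnipotent_mul_inv v (u ⟨v, hv⟩) x, inv_mul_cancel_right]
  calc diamondPi 2 K p u * (globalUnipotent K v x * heckeElement 2 K v 1 ^ a)
      = diamondElement 2 K v (u ⟨v, hv⟩) * (globalUnipotent K v x * heckeElement 2 K v 1 ^ a) * s' := by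
        rw [hs, mul_assoc, hcomm, ← mul_assoc]
    _ = globalUnipotent K v ((unitsToLocal 2 v (u ⟨v, hv⟩) 0 : (v.adicCompletion K)ˣ) * x *
          ((unitsToLocal 2 v (u ⟨v, hv⟩) 1)⁻¹ : (v.adicCompletion K)ˣ)) * heckeElement 2 K v 1 ^ a *
          (diamondElement 2 K v (u ⟨v, hv⟩) * s') := by
        rw [← mul_assoc (diamondElement 2 K v (u ⟨v, hv⟩)), h1, mul_assoc _ (diamondElement 2 K v (u ⟨v, hv⟩)),
          diamondElement_mul_heckeElement_pow, ← mul_assoc, mul_assoc _ (diamondElement 2 K v (u ⟨v, hv⟩)) s']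
    _ = _ := by rw [← hs]

/-- **The diamond transversal permutes the unipotent cosets**: for `s = ∏_w ⟨u_w⟩_w ∈ U(b', c)` and
the unipotent family `α_j = N(x_j) t` (indexed by `U(c₀,c₀) t U(c₀,c₀)/U(c₀,c₀)`, `1 ≤ c₀`) there is
an index map `σ` with `s α_j U(b,c) = α_{σ j} s U(b,c)` (`b' ≤ b ≤ c`).
[cite: Hida1994AIF, §2] -/
theorem exists_sigma_unipotentFamily (h𝒰 : 𝒰.IsMaximalAbove) (hv : (p : 𝓞 K) ∈ v.asIdeal)
    {c₀ : ℕ} (hc₀ : 1 ≤ c₀) {b' b c : ℕ} (hb : b' ≤ b) (hbc : b ≤ c)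
    (u : ∀ w : PlacesAbove K p, (Fin 2 → (w.1.adicCompletionIntegers K)ˣ)) (hu : diamondPi 2 K p u ∈ 𝒰.level b' c) :
    ∃ σ : ArithmeticQuotient.doubleCosetQuot (𝒰.level c₀ c₀) (heckeElement 2 K v 1 ^ 1) →
        ArithmeticQuotient.doubleCosetQuot (𝒰.level c₀ c₀) (heckeElement 2 K v 1 ^ 1),
      ∀ j, ((diamondPi 2 K p u * 𝒰.unipotentFamily (v := v) c₀ 1 j : FiniteAdelicGL 2 K) :
          FiniteAdelicGL 2 K ⧸ 𝒰.level b c) =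
        ((𝒰.unipotentFamily (v := v) c₀ 1 (σ j) * diamondPi 2 K p u : FiniteAdelicGL 2 K) :
          FiniteAdelicGL 2 K ⧸ 𝒰.level b c) := by
  -- `x'_j = u₀ x_j u₁⁻¹`
  set x' : ArithmeticQuotient.doubleCosetQuot (𝒰.level c₀ c₀) (heckeElement 2 K v 1 ^ 1) → v.adicCompletion K :=
    fun j => (unitsToLocal 2 v (u ⟨v, hv⟩) 0 : (v.adicCompletion K)ˣ) * 𝒰.unipotentRep v c₀ 1 j *
      ((unitsToLocal 2 v (u ⟨v, hv⟩) 1)⁻¹ : (v.adicCompletion K)ˣ) with hx'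
  have hx'1 : ∀ j, Valued.v (x' j) ≤ 1 := fun j => by
    have h1 := (𝒰.unipotentRep_spec h𝒰 hv hc₀ j.2).1
    have h0 : Valued.v ((unitsToLocal 2 v (u ⟨v, hv⟩) 0 : (v.adicCompletion K)ˣ) : v.adicCompletion K) = 1 :=
      valued_unitsToLocal v _ 0
    have h1' : Valued.v (((unitsToLocal 2 v (u ⟨v, hv⟩) 1)⁻¹ : (v.adicCompletion K)ˣ) : v.adicCompletion K) = 1 := by
      rw [Units.val_inv_eq_inv_val, map_inv₀, valued_unitsToLocal v _ 1, inv_one]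
    simp only [hx', map_mul, h0, h1', one_mul, mul_one]
    exact h1
  refine ⟨fun j => ⟨_, 𝒰.coe_globalUnipotent_mul_mem_doubleCosetQuot h𝒰 hv c₀ c₀ 1 (hx'1 j)⟩, fun j => ?_⟩
  set j' : ArithmeticQuotient.doubleCosetQuot (𝒰.level c₀ c₀) (heckeElement 2 K v 1 ^ 1) :=
    ⟨_, 𝒰.coe_globalUnipotent_mul_mem_doubleCosetQuot h𝒰 hv c₀ c₀ 1 (hx'1 j)⟩ with hj'
  -- `s α_j = N(x') t s`
  have hcomm := diamondPi_mul_globalUnipotent_mul hv u (𝒰.unipotentRep v c₀ 1 j) 1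
  change ((diamondPi 2 K p u * (globalUnipotent K v (𝒰.unipotentRep v c₀ 1 j) * heckeElement 2 K v 1 ^ 1) :
      FiniteAdelicGL 2 K) : FiniteAdelicGL 2 K ⧸ 𝒰.level b c) =
    ((𝒰.unipotentFamily c₀ 1 j' * diamondPi 2 K p u : FiniteAdelicGL 2 K) : FiniteAdelicGL 2 K ⧸ 𝒰.level b c)
  rw [hcomm]
  -- `N(x_{σ j}) t ≡ N(x') t` modulo `U(c₀,c₀)`, hence modulo `U(b,c)`
  have hspec := (𝒰.unipotentRep_spec h𝒰 hv hc₀ j'.2).2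
  change ((𝒰.unipotentFamily c₀ 1 j' : FiniteAdelicGL 2 K) : FiniteAdelicGL 2 K ⧸ 𝒰.level c₀ c₀) =
    ((globalUnipotent K v (x' j) * heckeElement 2 K v 1 ^ 1 : FiniteAdelicGL 2 K) :
      FiniteAdelicGL 2 K ⧸ 𝒰.level c₀ c₀) at hspec
  rw [unipotentFamily, 𝒰.globalUnipotent_coset_eq_iff h𝒰 hv, ← 𝒰.globalUnipotent_coset_eq_iff h𝒰 hv b c] at hspec
  obtain ⟨u₀, hu₀mem, hu₀⟩ : ∃ u₀ ∈ 𝒰.level b c, globalUnipotent K v (x' j) * heckeElement 2 K v 1 ^ 1 =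
      𝒰.unipotentFamily c₀ 1 j' * u₀ := by
    have h := QuotientGroup.eq.1 hspec
    exact ⟨_, h, by rw [unipotentFamily, mul_inv_cancel_left]⟩
  rw [hu₀, QuotientGroup.eq]
  have hgrp : (𝒰.unipotentFamily c₀ 1 j' * u₀ * diamondPi 2 K p u)⁻¹ * (𝒰.unipotentFamily c₀ 1 j' * diamondPi 2 K p u) =
      (diamondPi 2 K p u)⁻¹ * u₀⁻¹ * diamondPi 2 K p u := by group
  rw [hgrp]
  exact 𝒰.conj_mem_level hb hbc hu ((𝒰.level b c).inv_mem hu₀mem)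

/-! ### Normalising elements and local families -/

/-- `GL₂(𝒪_w) ≤ GL₂(K_w)`. [folklore] -/
abbrev localMaxCompact (w : HeightOneSpectrum (𝓞 K)) : Subgroup (GL (Fin 2) (w.adicCompletion K)) :=
  valuedCongruenceSubgroup (F := w.adicCompletion K) (Fin 2) (1 : WithZero (Multiplicative ℤ))

omit [Fact p.Prime] in
/-- For `z` normalising `L`, `L z L / L = {z L}` is enumerated by the one-element family. [folklore] -/
theorem bijOn_unit_of_normalizing (L : Subgroup (FiniteAdelicGL 2 K)) {z : FiniteAdelicGL 2 K}
    (hzn : ∀ u ∈ L, z⁻¹ * u * z ∈ L) :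
    Set.BijOn (fun _ : Unit => ((z : FiniteAdelicGL 2 K) : FiniteAdelicGL 2 K ⧸ L)) Set.univ
      (ArithmeticQuotient.doubleCosetQuot L z) := by
  rw [doubleCosetQuot_eq_singleton_of_normalizing hzn]
  exact ⟨fun _ _ => rfl, fun _ _ _ _ _ => Subsingleton.elim _ _, fun d hd => ⟨(), Set.mem_univ _, hd.symm⟩⟩

/-- **A local diagonal element commutes with `∏_w ⟨u_w⟩_w`.** [folklore] -/
theorem commute_ofLocal_glDiagonal_diamondPi (w : HeightOneSpectrum (𝓞 K))
    (d : Fin 2 → (w.adicCompletion K)ˣ) (u : ∀ w' : PlacesAbove K p, (Fin 2 → (w'.1.adicCompletionIntegers K)ˣ)) :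
    Commute (ofLocal 2 K w (glDiagonal 2 (w.adicCompletion K) d)) (diamondPi 2 K p u) := by
  rw [diamondPi]
  refine MonoidHom.commute_noncommPiCoprod _ (fun w' x => ?_) u
  by_cases hw : w'.1 = w
  · -- same place: diagonal elements commute
    have hx : diamondElement 2 K w'.1 x = ofLocal 2 K w (glDiagonal 2 (w.adicCompletion K) (hw ▸ unitsToLocal 2 w'.1 x)) := by
      subst hw; rw [diamondElement_apply]
    rw [hx, Commute, SemiconjBy, ← map_mul, ← map_mul, ← map_mul, ← map_mul, mul_comm]
  · exact (mul_ofLocal_comm (by rw [diamondElement_apply, localComponent_ofLocal_of_ne (Ne.symm hw)]) _).symm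

/-- **The local-coset family at a good place enumerates `L ι_w(x) L / L` for every level `L`
unramified at `w`** (with `Quotient.out` representatives of the local orbit). [cite: KhareThorne2017, §6.2] -/
theorem bijOn_localFamily {w : HeightOneSpectrum (𝓞 K)} {L : Subgroup (FiniteAdelicGL 2 K)}
    (hL : ArithmeticQuotient.IsUnramifiedLevel (localMaxCompact (K := K) w) (ofLocal 2 K w) (localComponent 2 K w) L)
    (x : GL (Fin 2) (w.adicCompletion K)) :
    Set.BijOn (fun y : MulAction.orbit (localMaxCompact (K := K) w)
        (x : GL (Fin 2) (w.adicCompletion K) ⧸ localMaxCompact (K := K) w) =>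
        ((ofLocal 2 K w y.1.out : FiniteAdelicGL 2 K) : FiniteAdelicGL 2 K ⧸ L)) Set.univ
      (ArithmeticQuotient.doubleCosetQuot L (ofLocal 2 K w x)) := by
  have h : (fun y : MulAction.orbit (localMaxCompact (K := K) w)
        (x : GL (Fin 2) (w.adicCompletion K) ⧸ localMaxCompact (K := K) w) =>
        ((ofLocal 2 K w y.1.out : FiniteAdelicGL 2 K) : FiniteAdelicGL 2 K ⧸ L)) = hL.localCoset ∘ Subtype.val := by
    funext y
    rw [Function.comp_apply, ← hL.localCoset_mk, QuotientGroup.out_eq']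
  rw [h]
  exact (hL.bijOn_localCoset x).comp ⟨fun y _ => y.2, Subtype.val_injective.injOn, fun z hz => ⟨⟨z, hz⟩, Set.mem_univ _, rfl⟩⟩

/-- The local orbit at a good place is finite (the global double coset is). [folklore] -/
theorem finite_localOrbit {w : HeightOneSpectrum (𝓞 K)} (hw : w ∉ 𝒰.bad) (b c : ℕ)
    (x : GL (Fin 2) (w.adicCompletion K)) :
    (MulAction.orbit (localMaxCompact (K := K) w)
      (x : GL (Fin 2) (w.adicCompletion K) ⧸ localMaxCompact (K := K) w)).Finite :=
  ((𝒰.isUnramifiedLevel_levelAt_of_not_mem (fun v => iwahoriLevel 2 v.1 b c) hw).finite_doubleCosetQuot_iff x).1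
    (finite_orbit_quotient (𝒰.level b c) (ofLocal 2 K w x))

/-! ### `res` commutes with the Hecke operators of all Hida elements -/

/-- **`res ∘ [U(b₁,c₁) g U(b₁,c₁)] = [U(b₂,c₂) g U(b₂,c₂)] ∘ res`** on `H^i(·, 1; k/p^s)` for every Hida
element `g` and `U(b₂,c₂) ≤ U(b₁,c₁)` (`c₁, c₂ ≥ 1`, `U` maximal above `p`).
[cite: KhareThorne2017, §6.2, Lemma 6.5] [cite: Hida1994AIF, §2] -/
theorem resCohomology_comp_laHecke (h𝒰 : 𝒰.IsMaximalAbove) (k : Type) [CommRing k] {b₁ c₁ b₂ c₂ : ℕ}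
    (hle : 𝒰.level b₂ c₂ ≤ 𝒰.level b₁ c₁) (hc₁ : 1 ≤ c₁) (hc₂ : 1 ≤ c₂) (s i : ℕ)
    {g : FiniteAdelicGL 2 K} (hg : g ∈ 𝒰.hidaElements) :
    (resCohomology (globalEmbedding 2 K) ⊤
        (1 : (⊤ : Submonoid (FiniteAdelicGL 2 K)) →* Module.End k (modPow k (p : k) s)) hle i).hom ∘ₗ
        𝒰.laHecke k b₁ c₁ s g i =
      𝒰.laHecke k b₂ c₂ s g i ∘ₗ (resCohomology (globalEmbedding 2 K) ⊤
        (1 : (⊤ : Submonoid (FiniteAdelicGL 2 K)) →* Module.End k (modPow k (p : k) s)) hle i).hom := by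
  classical
  obtain ⟨w, hw, ⟨d, hgd⟩, hcase⟩ := exists_place_of_mem_hidaElements_level 𝒰 h𝒰 hg
  rcases hcase with rfl | ⟨hN, -⟩
  · by_cases hp : (p : 𝓞 K) ∈ w.asIdeal
    · -- `U_{w,1}`: the unipotent family
      rw [← pow_one (heckeElement 2 K w 1)]
      exact resCohomology_comp_heckeCohomology_of_bijOn (globalEmbedding 2 K) ⊤ _ le_top le_top hle
        (Submonoid.mem_top _) (𝒰.unipotentFamily (v := w) 1 1)
        (𝒰.coe_unipotentFamily_bijOn_level h𝒰 hp le_rfl hc₂)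
        (𝒰.coe_unipotentFamily_bijOn_level h𝒰 hp le_rfl hc₁) i
    · -- `T_{w,1}` at a good place: the local family
      have hw' : w ∉ 𝒰.bad := Or.resolve_right hw hp
      haveI := (𝒰.finite_localOrbit hw' b₁ c₁ (glDiagonal 2 (w.adicCompletion K) d)).fintype
      rw [hgd]
      exact resCohomology_comp_heckeCohomology_of_bijOn (globalEmbedding 2 K) ⊤ _ le_top le_top hle
        (Submonoid.mem_top _) _
        (bijOn_localFamily (𝒰.isUnramifiedLevel_levelAt_of_not_mem (fun v => iwahoriLevel 2 v.1 b₂ c₂) hw') _)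
        (bijOn_localFamily (𝒰.isUnramifiedLevel_levelAt_of_not_mem (fun v => iwahoriLevel 2 v.1 b₁ c₁) hw') _) i
  · -- normalising elements
    exact resCohomology_comp_heckeCohomology_of_bijOn (globalEmbedding 2 K) ⊤ _ le_top le_top hle
      (Submonoid.mem_top _) (fun _ : Unit => g) (bijOn_unit_of_normalizing _ (hN b₂ c₂))
      (bijOn_unit_of_normalizing _ (hN b₁ c₁)) i

/-! ### `tr` commutes with the Hecke operators of all Hida elements -/

omit [Fact p.Prime] in
/-- A transversal given as `diamondPi '' S` from a transversal family. [folklore] -/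
theorem bijOn_image_of_bijOn {T : Type} [DecidableEq (FiniteAdelicGL 2 K)] (f : T → FiniteAdelicGL 2 K)
    {S : Finset T} {U : Subgroup (FiniteAdelicGL 2 K)} {D : Set (FiniteAdelicGL 2 K ⧸ U)}
    (hS : Set.BijOn (fun t => ((f t : FiniteAdelicGL 2 K) : FiniteAdelicGL 2 K ⧸ U)) S D) :
    Set.BijOn (fun s : FiniteAdelicGL 2 K => (s : FiniteAdelicGL 2 K ⧸ U)) (S.image f) D := by
  refine ⟨?_, ?_, ?_⟩
  · rintro _ hs
    obtain ⟨t, ht, rfl⟩ := Finset.mem_image.1 (Finset.mem_coe.1 hs)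
    exact hS.mapsTo (Finset.mem_coe.2 ht)
  · rintro _ hs₁ _ hs₂ h
    obtain ⟨t₁, ht₁, rfl⟩ := Finset.mem_image.1 (Finset.mem_coe.1 hs₁)
    obtain ⟨t₂, ht₂, rfl⟩ := Finset.mem_image.1 (Finset.mem_coe.1 hs₂)
    rw [hS.injOn (Finset.mem_coe.2 ht₁) (Finset.mem_coe.2 ht₂) h]
  · intro d hd
    obtain ⟨t, ht, rfl⟩ := hS.surjOn hd
    exact ⟨f t, Finset.mem_coe.2 (Finset.mem_image_of_mem f (Finset.mem_coe.1 ht)), rfl⟩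

/-- **`tr ∘ [U(b,c) g U(b,c)] = [U(b',c) g U(b',c)] ∘ tr`** on `H^i(·, 1; k/p^s)` for every Hida element
`g` and `b' ≤ b ≤ c`, `1 ≤ c` (`U` maximal above `p`; `tr = [U(b',c) 1 U(b,c)]`).
[cite: Hida1994AIF, §2] [cite: KhareThorne2017, §6.2, Lemma 6.5] -/
theorem trCohomology_comp_laHecke (h𝒰 : 𝒰.IsMaximalAbove) (k : Type) [CommRing k] {b' b c : ℕ}
    (hb : b' ≤ b) (hbc : b ≤ c) (hc : 1 ≤ c) (s i : ℕ) {g : FiniteAdelicGL 2 K} (hg : g ∈ 𝒰.hidaElements) :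
    (trCohomology (globalEmbedding 2 K) ⊤
        (1 : (⊤ : Submonoid (FiniteAdelicGL 2 K)) →* Module.End k (modPow k (p : k) s))
        (le_top : (𝒰.level b c).toSubmonoid ≤ ⊤) (le_top : (𝒰.level b' c).toSubmonoid ≤ ⊤) i).hom ∘ₗ
        𝒰.laHecke k b c s g i =
      𝒰.laHecke k b' c s g i ∘ₗ (trCohomology (globalEmbedding 2 K) ⊤
        (1 : (⊤ : Submonoid (FiniteAdelicGL 2 K)) →* Module.End k (modPow k (p : k) s))
        (le_top : (𝒰.level b c).toSubmonoid ≤ ⊤) (le_top : (𝒰.level b' c).toSubmonoid ≤ ⊤) i).hom := by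
  classical
  have hle : 𝒰.level b c ≤ 𝒰.level b' c := 𝒰.level_antitone hb le_rfl
  -- the diamond transversal
  obtain ⟨S, hSb, hS⟩ := 𝒰.exists_diamond_transversal h𝒰 hbc (le_max_of_le_right hc) (b' := b')
  have hS' := bijOn_image_of_bijOn (diamondPi 2 K p) hS
  have hmemS : ∀ s ∈ S.image (diamondPi 2 K p), ∃ u ∈ S, s = diamondPi 2 K p u := fun s hs => by
    obtain ⟨u, hu, rfl⟩ := Finset.mem_image.1 hs
    exact ⟨u, hu, rfl⟩
  have hSlevel : ∀ u ∈ S, diamondPi 2 K p u ∈ 𝒰.level b' c := fun u hu => 𝒰.diamondPi_mem_level h𝒰 c u (hSb u hu)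
  obtain ⟨w, hw, ⟨d, hgd⟩, hcase⟩ := exists_place_of_mem_hidaElements_level 𝒰 h𝒰 hg
  rcases hcase with rfl | ⟨hN, -⟩
  · by_cases hp : (p : 𝓞 K) ∈ w.asIdeal
    · -- `U_{w,1}`: unipotent family, index maps from `exists_sigma_unipotentFamily`
      have hex : ∀ s ∈ S.image (diamondPi 2 K p),
          ∃ σ : ArithmeticQuotient.doubleCosetQuot (𝒰.level c c) (heckeElement 2 K w 1 ^ 1) →
            ArithmeticQuotient.doubleCosetQuot (𝒰.level c c) (heckeElement 2 K w 1 ^ 1),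
            ∀ j, ((s * 𝒰.unipotentFamily (v := w) c 1 j : FiniteAdelicGL 2 K) : FiniteAdelicGL 2 K ⧸ 𝒰.level b c) =
              ((𝒰.unipotentFamily (v := w) c 1 (σ j) * s : FiniteAdelicGL 2 K) : FiniteAdelicGL 2 K ⧸ 𝒰.level b c) :=
        fun s hs => by
          obtain ⟨u, hu, rfl⟩ := hmemS s hs
          exact 𝒰.exists_sigma_unipotentFamily (v := w) h𝒰 hp hc hb hbc u (hSlevel u hu)
      choose σ hσ using hex
      rw [← pow_one (heckeElement 2 K w 1)]
      refine trCohomology_comp_heckeCohomology (globalEmbedding 2 K) ⊤ _ le_top le_top hle hS'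
        (Submonoid.mem_top _) (𝒰.unipotentFamily (v := w) c 1) (fun _ => Submonoid.mem_top _)
        (𝒰.coe_unipotentFamily_bijOn_level h𝒰 hp hc hc)
        (𝒰.coe_unipotentFamily_bijOn_level h𝒰 hp hc hc)
        (fun s j => if h : s ∈ S.image (diamondPi 2 K p) then σ s h j else j)
        (fun s hs j => ?_) i
      rw [dif_pos hs]
      exact hσ s hs j
    · -- `T_{w,1}` at a good place: representatives commute with the transversal
      have hw' : w ∉ 𝒰.bad := Or.resolve_right hw hp
      haveI := (𝒰.finite_localOrbit hw' b c (glDiagonal 2 (w.adicCompletion K) d)).fintype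
      have hU := 𝒰.isUnramifiedLevel_levelAt_of_not_mem (fun v => iwahoriLevel 2 v.1 b c) hw'
      rw [hgd]
      refine trCohomology_comp_heckeCohomology (globalEmbedding 2 K) ⊤ _ le_top le_top hle hS'
        (Submonoid.mem_top _) _ (fun _ => Submonoid.mem_top _)
        (bijOn_localFamily hU _)
        (bijOn_localFamily (𝒰.isUnramifiedLevel_levelAt_of_not_mem (fun v => iwahoriLevel 2 v.1 b' c) hw') _)
        (fun _ j => j) (fun s hs j => ?_) i
      obtain ⟨u, hu, rfl⟩ := hmemS s hs
      rw [hU.comm_of_apply_eq_one _ (localComponent_diamondPi_of_not_mem u hp)]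
  · -- normalising elements commuting with the transversal
    refine trCohomology_comp_heckeCohomology (globalEmbedding 2 K) ⊤ _ le_top le_top hle hS'
      (Submonoid.mem_top _) (fun _ : Unit => g) (fun _ => Submonoid.mem_top _)
      (bijOn_unit_of_normalizing _ (hN b c)) (bijOn_unit_of_normalizing _ (hN b' c))
      (fun _ j => j) (fun s hs j => ?_) i
    obtain ⟨u, hu, rfl⟩ := hmemS s hs
    rw [hgd, ← (commute_ofLocal_glDiagonal_diamondPi w d u).eq]

end TameLevel

end BigHeckeGLn

end Literature.NumberTheory.Automorphic
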